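/-
Copyright (c) 2026. All rights reserved.
Released under Apache 2.0 license as described in the file LICENSE.
Authors: abc-iut cell, seat abc-iut-w5-d053 (gen 4; row «COR36-FULL-NV-SLIM» — the SLIM affine witness for the
residual hypothesis of the [AbsTopIII] Cor 3.6 / Cor 3.7 model column).
-/
import Literature.AnabelianGeometry.AbsoluteAnabelian.AbsTopIII.MLFGaloisModelAffineWitnessSlim
import Literature.AnabelianGeometry.AbsoluteAnabelian.AbsTopIII.MLFGaloisModelAffineWitnessFull
import Mathlib.Analysis.SpecificLimits.Normed
import HarnessLib

/-!
# [AbsTopIII] Cor 3.6 / Cor 3.7 at the MLF model: print's proxy hypotheses {`Π` SLIM, Prop 3.2 (iv)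
# surjectivity} hold JOINTLY on the nonempty type `P₀^an` of analytic affine witness objects — proofs

S. Mochizuki, *Topics in absolute anabelian geometry III* [MochizukiAbsTopIII2015] (kurims manuscript
`paper:url-5493eb38cbb7`), Prop 3.2 (iv) p. 72; Cor 3.6 pp. 78–82; Cor 3.7 pp. 86–89.

PROOF-ONLY companion (seat abc-iut-w5-d053 gen 4) of `MLFGaloisModelAffineWitnessSlim.lean` (the analytic
witness object `affineModelAn k = (Π₀^an(k) ↠ G_k ↷ ℚ̄_p)`, `Π₀^an(k) = ℚ̄_p ⋊ (ℚ̄_p^× ⋊ G_k)` with the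
analytic topology).  The theorems of record of the Cor 3.6 / Cor 3.7 model column carry TWO hypotheses on the
type `P` of objects — `hP : ∀ A, P A → IsSlimGroup A.pair.Pi` (print's "strictly Belyi type ⇒ `Π` slim",
Prop 3.2 (iv) / [AbsTopI] Prop 2.3 (ii)) and `hfull : (P.ι ⋙ TFModel.gal p).Full` (Prop 3.2 (iv)
surjectivity ⟺ `AnabelianInput` ⟺ `θ^bi`) — which so far had NO joint non-vacuous instance (slim type: NOT
full, `not_full_gal_slim` / `isEmpty_anabelianInput_slim`; discrete affine witness: full but NOT slim,
`not_isSlimGroup_affPi`).  Here: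

* `AffPiAn.exists_ball_tr_mem` / `exists_dil_mem` — an open subgroup of `Π₀^an(k)` contains all small
  translations and a dilation `x ↦ (1 + pⁿ)·x ≠ id`;
* **`AffPiAn.isSlimGroup` — `Π₀^an(k)` IS SLIM**: a centraliser of an open subgroup satisfies `a·γ(t) = t`
  for small `t`, hence (scaling by `pⁿ`, `ℚ_p`-linearity of `γ`) for all `t`, so `a = 1`, `γ = 1`; and
  `(a' - 1)·b = 0` from the dilation;
* `exists_hom_affineModelAn`, **`full_galP_isAffineModelAn`** — `Full` on the nonempty type `P₀^an`
  (affine-group rigidity `AffPi.exists_ringEquiv_of_mulEquiv` of `…AffineWitnessProofs.lean`; open images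
  because the group isomorphism is a homeomorphism); `isIdRigid_isAffineModelAn` (abc-iut-L4-t9's
  `isIdRigid_fullSubcategory_of_slim` AS STATED); `slim_and_full_isAffineModelAn`;
* `nonempty_anabelianInput_isAffineModelAn`, `ker_and_galoisIsoLiftsToTFPairIso_isAffineModelAn` — the
  Cor-1.10 datum over a SLIM nonempty sub-model, and the F-2995 schema at a predicate of slim pairs;
* **`logFrobeniusCompatible_isAffineModelAn`, `cor_3_7_isAffineModelAn`** — abc-iut-L4-t5's
  `logFrobeniusCompatible_model_of_full` and abc-iut-L4-t9's `model_of_cor_3_7_of_full` instantiated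
  VERBATIM (slimness, fullness, base object all supplied): [AbsTopIII] Cor 3.6 (i)–(v) and Cor 3.7 (i)–(v)
  at `𝒳_{P₀^an}` with no residual input; `compat_isAffineModelAn` (the w5-d053 / w6-d023 / w6-d025
  compatibility theorems there).

HONEST FRAMING: `Π₀^an` is slim but NOT profinite / locally compact and NOT of hyperbolic-orbicurve /
strictly-Belyi type; a CONSISTENCY / NON-VACUITY witness that the typed hypothesis structure of the model
column — «`Π` slim ∧ Prop 3.2 (iv) bijectivity ∧ Cor-1.10 datum» — is jointly satisfiable over GENUINE MLF
Galois groups, NOT a model of [AbsTopIII] Cor 1.10.  No new `Prop` fact (F-2995 consumed BY NAME through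
abc-iut-L4-t9's iff); no definition; nothing here bears on [IUTchIII] Cor. 3.12; instantiated ≠ endorsed;
model-level ≠ node-level.
-/

set_option autoImplicit false

noncomputable section

namespace Literature.AnabelianGeometry.AbsoluteAnabelian.AbsTopIII

open Topology Filter CategoryTheory
open Literature.AlgebraicGeometry.Frobenioids (IsSlimGroup)

variable {p : ℕ} [hp : Fact p.Prime]

namespace TFModel

namespace AffPiAn

variable {k : IntermediateField ℚ_[p] (PadicAlgCl p)}

/-! ## `Π₀^an(k)` is SLIM -/

/-- An open subgroup of `Π₀^an(k)` contains all small translations `x ↦ x + t`, `‖t‖ < ε`.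
[cite: MochizukiAbsTopIII2015, Proposition 3.2 (iv) p.72] -/
theorem exists_ball_tr_mem (U : Subgroup (AffPiAn k)) (hU : IsOpen (U : Set (AffPiAn k))) :
    ∃ ε > 0, ∀ t : PadicAlgCl p, ‖t‖ < ε → tr t ∈ U := by
  have hpre : IsOpen (tr (k := k) ⁻¹' (U : Set (AffPiAn k))) := hU.preimage continuous_tr
  have h0 : (0 : PadicAlgCl p) ∈ tr (k := k) ⁻¹' (U : Set (AffPiAn k)) := by
    change (show AffPiAn k from AffPi.tr 0) ∈ U
    rw [AffPi.tr_zero]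
    exact U.one_mem
  obtain ⟨ε, hε, hball⟩ := Metric.isOpen_iff.1 hpre 0 h0
  refine ⟨ε, hε, fun t ht => hball ?_⟩
  rwa [Metric.mem_ball, dist_zero_right]

/-- An open subgroup of `Π₀^an(k)` contains a dilation `x ↦ a·x` with `a ≠ 1` (namely `a = 1 + pⁿ` for
large `n`). [cite: MochizukiAbsTopIII2015, Proposition 3.2 (iv) p.72] -/
theorem exists_dil_mem (U : Subgroup (AffPiAn k)) (hU : IsOpen (U : Set (AffPiAn k))) :
    ∃ a : (PadicAlgCl p)ˣ, (a : PadicAlgCl p) ≠ 1 ∧ dil a ∈ U := by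
  -- `uₙ := 1 + pⁿ → 1` in `ℚ̄_p^×`
  have hp1 : ‖(p : PadicAlgCl p)‖ < 1 := by
    rw [PadicAlgCl.norm_natCast_prime]
    exact inv_lt_one_of_one_lt₀ (by exact_mod_cast hp.out.one_lt)
  have hpow : Tendsto (fun n : ℕ => (p : PadicAlgCl p) ^ n) atTop (𝓝 0) :=
    tendsto_pow_atTop_nhds_zero_of_norm_lt_one hp1
  have hne : ∀ n : ℕ, (1 : PadicAlgCl p) + (p : PadicAlgCl p) ^ (n + 1) ≠ 0 := by
    intro n h
    have h1 : ‖(p : PadicAlgCl p) ^ (n + 1)‖ < 1 := by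
      rw [norm_pow]; exact pow_lt_one₀ (norm_nonneg _) hp1 (Nat.succ_ne_zero n)
    have h2 : (p : PadicAlgCl p) ^ (n + 1) = -1 := eq_neg_of_add_eq_zero_right h
    rw [h2, norm_neg, norm_one] at h1
    exact lt_irrefl _ h1
  let u : ℕ → (PadicAlgCl p)ˣ := fun n => Units.mk0 _ (hne n)
  have hu : Tendsto u atTop (𝓝 1) := by
    rw [Units.isEmbedding_val₀.tendsto_nhds_iff]
    have h1 : Tendsto (fun n : ℕ => (1 : PadicAlgCl p) + (p : PadicAlgCl p) ^ (n + 1)) atTop (𝓝 (1 + 0)) :=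
      tendsto_const_nhds.add ((tendsto_add_atTop_iff_nat 1).2 hpow)
    rw [add_zero] at h1
    exact h1
  have hpre : dil (k := k) ⁻¹' (U : Set (AffPiAn k)) ∈ 𝓝 (1 : (PadicAlgCl p)ˣ) := by
    refine (hU.preimage continuous_dil).mem_nhds ?_
    change (show AffPiAn k from AffPi.dil 1) ∈ U
    have : (AffPi.dil 1 : AffPi k) = 1 := by ext <;> simp [AffPi.dil]
    rw [this]
    exact U.one_mem
  obtain ⟨n, hn⟩ := (hu.eventually hpre).exists
  refine ⟨u n, ?_, hn⟩
  intro h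
  have : (p : PadicAlgCl p) ^ (n + 1) = 0 := by
    have e : ((u n : (PadicAlgCl p)ˣ) : PadicAlgCl p) = 1 + (p : PadicAlgCl p) ^ (n + 1) := rfl
    rw [h] at e
    linear_combination -e
  exact pow_ne_zero _ (Nat.cast_ne_zero.2 hp.out.ne_zero) this

/-- **`Π₀^an(k)` is SLIM**: an element `z = (b, a, γ)` centralising an open subgroup centralises all small
translations, so `a·γ(t) = t` for `‖t‖ < ε`, hence (scaling by `pⁿ`, `γ` being `ℚ_p`-linear) for all
`t ∈ ℚ̄_p`, i.e. `a = 1`, `γ = 1`; and it centralises a dilation by `a' ≠ 1`, so `(a' - 1)·b = 0`, `b = 0`.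
[cite: MochizukiAbsTopIII2015, Proposition 3.2 (iv) p.72] -/
theorem isSlimGroup : IsSlimGroup (AffPiAn k) := by
  refine ⟨fun U hU => ?_⟩
  rw [eq_bot_iff]
  intro z hz
  rw [Subgroup.mem_centralizer_iff] at hz
  obtain ⟨ε, hε, htr⟩ := exists_ball_tr_mem U hU
  obtain ⟨a', ha', hdil⟩ := exists_dil_mem U hU
  -- (1) `a·γ(t) = t` for small `t` (`z = (b, a, γ)`)
  have hsmall : ∀ t : PadicAlgCl p, ‖t‖ < ε → ((toAff z).u : PadicAlgCl p) * (toAff z).γ t = t := by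
    intro t ht
    have e := congrArg (fun w : AffPiAn k => (toAff w).t) (hz (tr t) (htr t ht))
    change (AffPi.tr t * toAff z).t = (toAff z * AffPi.tr t).t at e
    simp only [AffPi.mul_t, AffPi.tr_t, AffPi.tr_u, AffPi.tr_γ, Units.val_one, AlgEquiv.one_apply,
      one_mul] at e
    -- e : t + b = b + a * γ t
    linear_combination -e
  -- (2) hence for all `t`
  have hp1 : ‖(p : PadicAlgCl p)‖ < 1 := by
    rw [PadicAlgCl.norm_natCast_prime]
    exact inv_lt_one_of_one_lt₀ (by exact_mod_cast hp.out.one_lt)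
  have hall : ∀ t : PadicAlgCl p, ((toAff z).u : PadicAlgCl p) * (toAff z).γ t = t := by
    intro t
    have hlim : Tendsto (fun n : ℕ => (p : PadicAlgCl p) ^ n * t) atTop (𝓝 0) := by
      have := (tendsto_pow_atTop_nhds_zero_of_norm_lt_one hp1).mul_const t
      rwa [zero_mul] at this
    obtain ⟨n, hn⟩ := ((Metric.tendsto_nhds.1 hlim) ε hε).exists
    rw [dist_zero_right] at hn
    have e := hsmall _ hn
    rw [map_mul, map_pow, map_natCast] at e
    have hpn : (p : PadicAlgCl p) ^ n ≠ 0 := pow_ne_zero _ (Nat.cast_ne_zero.2 hp.out.ne_zero)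
    -- e : a * (p^n * γ t) = p^n * t
    have : (p : PadicAlgCl p) ^ n * (((toAff z).u : PadicAlgCl p) * (toAff z).γ t - t) = 0 := by
      linear_combination e
    rcases mul_eq_zero.1 this with h | h
    · exact absurd h hpn
    · exact sub_eq_zero.1 h
  have ha1 : ((toAff z).u : PadicAlgCl p) = 1 := by simpa using hall 1
  have hγ1 : (toAff z).γ = 1 := AlgEquiv.ext fun t => by
    have e := hall t
    rw [ha1, one_mul] at e
    exact e
  -- (3) `b = 0` from the dilation `a' ≠ 1`
  have hb0 : (toAff z).t = 0 := by
    have e := congrArg (fun w : AffPiAn k => (toAff w).t) (hz (dil a') hdil)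
    change (AffPi.dil a' * toAff z).t = (toAff z * AffPi.dil a').t at e
    simp only [AffPi.mul_t, AffPi.dil_t, AffPi.dil_u, AffPi.dil_γ, AlgEquiv.one_apply, map_zero,
      mul_zero, add_zero, zero_add] at e
    -- e : a' * b = b
    have : ((a' : PadicAlgCl p) - 1) * (toAff z).t = 0 := by linear_combination e
    rcases mul_eq_zero.1 this with h | h
    · exact absurd (sub_eq_zero.1 h) ha'
    · exact h
  rw [Subgroup.mem_bot]
  change toAff z = (1 : AffPi k)
  ext
  · exact hb0
  · rw [ha1, AffPi.one_u, Units.val_one]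
  · rw [hγ1, AffPi.one_γ]

end AffPiAn

/-! ## `Full`, slimness and id-rigidity on the nonempty type `P₀^an = IsAffineModelAn` -/

section

variable {k : IntermediateField ℚ_[p] (PadicAlgCl p)} [FiniteDimensional ℚ_[p] k]

/-- The arithmetic kernel of the analytic witness object is `ker ε`.
[cite: MochizukiAbsTopIII2015, Definition 3.1 (ii) p.67] -/
theorem mem_actionKer_affineModelAn_iff (g : (affineModelAn k).pair.Pi) :
    g ∈ (affineModelAn k).pair.actionKer ↔ (AffPiAn.toAff (show AffPiAn k from g)).γ = 1 := by
  rw [GaloisFieldPair.actionKer, MonoidHom.mem_ker, RingEquiv.ext_iff, AlgEquiv.ext_iff]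
  exact Iff.rfl

end

/-- **Every object of `P₀^an` has SLIM `Π_k`** (print's proxy hypothesis for "strictly Belyi type" in the
model column). [cite: MochizukiAbsTopIII2015, Proposition 3.2 (iv) p.72] -/
theorem isSlimGroup_of_isAffineModelAn {A : TFModel p} (hA : IsAffineModelAn A) : IsSlimGroup A.pair.Pi := by
  obtain ⟨k, _, rfl⟩ := hA
  exact AffPiAn.isSlimGroup

section

variable {k₁ k₂ : IntermediateField ℚ_[p] (PadicAlgCl p)} [FiniteDimensional ℚ_[p] k₁]
  [FiniteDimensional ℚ_[p] k₂]

/-- **Every isomorphism of topological groups `Π₀^an(k₁) ⥲ Π₀^an(k₂)` is the Galois component of a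
Galois-isomorphism `affineModelAn k₁ ⟶ affineModelAn k₂`** (affine-group rigidity
`AffPi.exists_ringEquiv_of_mulEquiv` for the underlying abstract isomorphism; open images because the map
is a homeomorphism). [cite: MochizukiAbsTopIII2015, Proposition 3.2 (iv) p.72] -/
theorem exists_hom_affineModelAn (φ : AffPiAn k₁ ≃ₜ* AffPiAn k₂) :
    ∃ f : affineModelAn k₁ ⟶ affineModelAn k₂, ∀ x : AffPiAn k₁, (f : Hom _ _).hom.homPi x = φ x := by
  obtain ⟨σ, hσ⟩ := AffPi.exists_ringEquiv_of_mulEquiv (k₁ := k₁) (k₂ := k₂)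
    (AffPiAn.toAff.symm.trans (φ.toMulEquiv.trans AffPiAn.toAff))
  refine ⟨{ hom :=
              { homPi := φ.toMulEquiv.toMonoidHom
                continuous_homPi := φ.continuous
                homM := σ.toRingHom
                smul_comm := fun g x => hσ g x
                comap_ker := by
                  ext g
                  rw [Subgroup.mem_comap, mem_actionKer_affineModelAn_iff, mem_actionKer_affineModelAn_iff]
                  exact AffPi.γ_map_eq_one_iff
                    (AffPiAn.toAff.symm.trans (φ.toMulEquiv.trans AffPiAn.toAff)) g
                isOpen_image := fun U hU => by
                  have hopen : IsOpen ((U.map φ.toMulEquiv.toMonoidHom : Subgroup (AffPiAn k₂)) :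
                      Set (AffPiAn k₂)) := by
                    rw [Subgroup.coe_map]
                    exact φ.toHomeomorph.isOpenMap _ hU
                  exact Subgroup.isOpen_mono le_sup_left hopen }
            bijective := φ.bijective
            isOpenMap := φ.toHomeomorph.isOpenMap }, fun x => rfl⟩

end

/-- **Prop 3.2 (iv) SURJECTIVITY HOLDS on the nonempty type `P₀^an` of analytic affine witness objects**:
`(Π ↷ ℚ̄_p) ↦ Π` is FULL on `𝒳_{P₀^an}`. [cite: MochizukiAbsTopIII2015, Proposition 3.2 (iv) p.72] -/
theorem full_galP_isAffineModelAn : (galP p (IsAffineModelAn (p := p))).Full :=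
  ⟨fun {X Y} g => by
    obtain ⟨A, k₁, hk₁, rfl⟩ := X
    obtain ⟨B, k₂, hk₂, rfl⟩ := Y
    obtain ⟨f, hf⟩ := exists_hom_affineModelAn (k₁ := k₁) (k₂ := k₂) (TopGroupObj.Hom.iso g)
    exact ⟨ObjectProperty.homMk f, TopGroupObj.Hom.ext fun x => hf x⟩⟩

/-- **`𝒳_{P₀^an}` is id-rigid** — by abc-iut-L4-t9's `isIdRigid_fullSubcategory_of_slim` AS STATED (slim
objects). [cite: MochizukiAbsTopIII2015, Proposition 3.2 (iv) p.72] -/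
theorem isIdRigid_isAffineModelAn : IsIdRigid (IsAffineModelAn (p := p)).FullSubcategory :=
  isIdRigid_fullSubcategory_of_slim _ fun _ h => isSlimGroup_of_isAffineModelAn h

/-- **print's proxy hypothesis set of the model column — {slim, Full, Lemma 3.4, an object} — is JOINTLY
and NON-VACUOUSLY satisfiable at `P₀^an`** (Lemma 3.4 being a theorem at every `P`).
[cite: MochizukiAbsTopIII2015, Corollary 3.6 p.78] -/
theorem slim_and_full_isAffineModelAn :
    (∀ A : TFModel p, IsAffineModelAn A → IsSlimGroup A.pair.Pi) ∧ (galP p (IsAffineModelAn (p := p))).Full ∧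
      Nonempty (IsAffineModelAn (p := p)).FullSubcategory :=
  ⟨fun _ h => isSlimGroup_of_isAffineModelAn h, full_galP_isAffineModelAn,
    nonempty_isAffineModelAn_fullSubcategory⟩

/-- The Cor-1.10 input datum of Cor 3.6 over the SLIM nonempty sub-model `𝒳_{P₀^an}` is inhabited
(contrast: `isEmpty_anabelianInput_slim` over the type of ALL slim objects).
[cite: MochizukiAbsTopIII2015, Corollary 3.6 (ii) p.79] -/
theorem nonempty_anabelianInput_isAffineModelAn :
    Nonempty (AnabelianInput p (IsAffineModelAn (p := p)) (IsAffineModelAn (p := p)).FullSubcategory) :=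
  (nonempty_anabelianInput_iff_full p _).2 full_galP_isAffineModelAn

/-- The printed residual in abc-iut-L4-t9's form holds on `P₀^an`: kernels respected and the F-2995 schema
`GaloisIsoLiftsToTFPairIsoOfStrictlyBelyi` at the predicate "is the pair of a `P₀^an`-object" (objects with
SLIM `Π`). [cite: MochizukiAbsTopIII2015, Proposition 3.2 (iv) p.72] -/
theorem ker_and_galoisIsoLiftsToTFPairIso_isAffineModelAn :
    (∀ A B : TFModel p, IsAffineModelAn A → IsAffineModelAn B → ∀ f : A.pair.Pi ≃ₜ* B.pair.Pi,
        A.pair.actionKer.map f.toMulEquiv.toMonoidHom = B.pair.actionKer) ∧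
      GaloisIsoLiftsToTFPairIsoOfStrictlyBelyi
        (fun Q => ∃ A : TFModel p, IsAffineModelAn A ∧ A.pair = Q) :=
  (full_ι_gal_iff_ker_and_galoisIsoLiftsToTFPairIso _).mp full_galP_isAffineModelAn

/-! ## The `_of_full` theorems of the model column, instantiated VERBATIM (slimness supplied) -/

/-- **[AbsTopIII] Cor 3.6 (i)–(v) at the SLIM sub-model `𝒳_{P₀^an}`**: abc-iut-L4-t5's
`logFrobeniusCompatible_model_of_full` AS STATED, with `hfull`, `hP` (slimness) and `x₀` all supplied —
no residual input. [cite: MochizukiAbsTopIII2015, Corollary 3.6 (i)–(v) pp.78–82] -/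
theorem logFrobeniusCompatible_isAffineModelAn :
    (monoAnabelianData (AnabelianInput.ofFull p (IsAffineModelAn (p := p)) full_galP_isAffineModelAn)).toLogFrobeniusData.LogFrobeniusCompatible
      (monoAnabelianData (AnabelianInput.ofFull p (IsAffineModelAn (p := p)) full_galP_isAffineModelAn)).telecoreData :=
  logFrobeniusCompatible_model_of_full full_galP_isAffineModelAn (fun _ h => isSlimGroup_of_isAffineModelAn h)
    ⟨affineModelAn ⊥, isAffineModelAn_affineModelAn ⊥⟩

/-- **[AbsTopIII] Cor 3.6 (iii) cores half / (v) sentences 3–4 at `𝒳_{P₀^an}`** (abc-iut-w5-d053 /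
w6-d023 / w6-d025 model theorems, non-vacuous slim instance). [cite: MochizukiAbsTopIII2015, Corollary 3.6 (iii),(v) p.80] -/
theorem compat_isAffineModelAn :
    (monoAnabelianData (AnabelianInput.ofFull p (IsAffineModelAn (p := p)) full_galP_isAffineModelAn)).toLogFrobeniusData.LogObsCompatCoresStmt ∧
      (monoAnabelianData (AnabelianInput.ofFull p (IsAffineModelAn (p := p)) full_galP_isAffineModelAn)).toLogFrobeniusData.ShiftCompatStmt ∧
      (monoAnabelianData (AnabelianInput.ofFull p (IsAffineModelAn (p := p)) full_galP_isAffineModelAn)).toLogFrobeniusData.ShiftTelecoreCompatStmt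
        (monoAnabelianData (AnabelianInput.ofFull p (IsAffineModelAn (p := p)) full_galP_isAffineModelAn)).telecoreData :=
  ⟨logObsCompatCoresStmt_model _, shiftCompatStmt_model _, shiftTelecoreCompatStmt_model _⟩

/-- **[AbsTopIII] Cor 3.7 (i)–(v) at the SLIM sub-model `𝒳_{P₀^an}`**: abc-iut-L4-t9's
`model_of_cor_3_7_of_full` AS STATED, with `hP` (slimness), `x₀` and `hfull` all supplied — no residual
input. [cite: MochizukiAbsTopIII2015, Corollary 3.7 (i)–(v) pp.86–89] -/
theorem cor_3_7_isAffineModelAn :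
    ((modelSetting p).restrict (IsAffineModelAn (p := p)) fun _ h => h).Cor_3_7_i ∧
      ((modelSetting p).restrict (IsAffineModelAn (p := p)) fun _ h => h).Cor_3_7_ii
        (biAnabelianLiftOfFull p _ full_galP_isAffineModelAn) ∧
      Literature.AnabelianGeometry.AbsoluteAnabelian.AbsTopIII.BiAnabelianSetting.Cor_3_7_iii
        ((modelSetting p).restrict (IsAffineModelAn (p := p)) fun _ h => h) ∧
      ((modelSetting p).restrict (IsAffineModelAn (p := p)) fun _ h => h).Cor_3_7_iv
        (biAnabelianLiftOfFull p _ full_galP_isAffineModelAn) ∧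
      ((modelSetting p).restrict (IsAffineModelAn (p := p)) fun _ h => h).Cor_3_7_v :=
  model_of_cor_3_7_of_full p _ (fun _ h => isSlimGroup_of_isAffineModelAn h) (affineModelAn ⊥)
    (isAffineModelAn_affineModelAn ⊥) full_galP_isAffineModelAn

end TFModel

end Literature.AnabelianGeometry.AbsoluteAnabelian.AbsTopIII

end
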